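import Summits.PneNP.PneNP.Theses.NtimeComplementLadder
import Literature.Computability.Complexity.PaulPippengerSzemerediTrotter1983Collapse
import Literature.Computability.Complexity.DTIMESubsetNTIMELinear
import Literature.Computability.Complexity.DiagMachine

/-!
# `ConlinNotInNlin`, line `birth` (door W): the speed-up stub needs at least two alternations

Negative knowledge for the registered stub
`stub_speedup : ∃ (g : ℕ → ℕ) (j : ℕ), IsTimeConstructible g ∧ (n + 1 = o(g n)) ∧ NTIME g ⊆ sigmaLin j`
of the birth skeleton of crux `stmt-PneNP-18521` (`NtimeComplementLadder.ConlinNotInNlin`): its instances at the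
levels `j = 0` (`sigmaLin 0 = DTIME(n)`) and `j = 1` (`sigmaLin 1 ⊆ NTIME(n)`) are FALSE unconditionally, by Žák's
nondeterministic time hierarchy (`Diag.ntime_hierarchy_holds`, proved in the tree). Hence any proof of the stub
must place `NTIME(g)` at `Σ₂TIME(n)` or higher — the nondeterministic analogue of Gupta's `Σ₂` form of the PPST
speed-up. (Refuter tightness lemma; it does not assert any Theses decl.)
-/

set_option linter.dupNamespace false

namespace Summit.PneNP.PneNP.Theorems.ConlinNotInNlin.Negative

open Filter Asymptotics Literature.Computability.Complexity

/-- `sigmaLin j ⊆ NTIME(n)` for `j ≤ 1` (`sigmaLin 0 = DTIME(n) ⊆ NTIME(n)`, `sigmaLin 1 ⊆ NTIME(n)`). -/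
theorem sigmaLin_subset_NTIME_id_of_le_one {j : ℕ} (hj : j ≤ 1) : sigmaLin j ⊆ NTIME (fun n => n) := by
  interval_cases j
  · rw [sigmaLin_zero]; exact DTIME_id_subset_NTIME_id
  · exact sigmaLin_one_subset_NTIME_id

/-- **Door W needs `j ≥ 2`.** No time-constructible superlinear `g` has `NTIME g ⊆ sigmaLin j` with `j ≤ 1`:
such an inclusion would put `NTIME g` inside `NTIME(n)`, contradicting `Diag.ntime_hierarchy_holds`
(`f = id`, `isTimeConstructible_id`). The `j ≤ 1` slice of the skeleton stub `stub_speedup` is refuted. -/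
theorem stub_speedup_false_at_level_le_one :
    ¬ ∃ (g : ℕ → ℕ) (j : ℕ), j ≤ 1 ∧ IsTimeConstructible g ∧
      ((fun n => ((n + 1 : ℕ) : ℝ)) =o[atTop] fun n => (g n : ℝ)) ∧ NTIME g ⊆ sigmaLin j := by
  rintro ⟨g, j, hj, hg, hlittle, hspeed⟩
  exact Diag.ntime_hierarchy_holds (fun n => n) g isTimeConstructible_id hg hlittle
    (hspeed.trans (sigmaLin_subset_NTIME_id_of_le_one hj))

/-- Pointwise form at `j = 1`: for every time-constructible `g` with `n + 1 = o(g n)`, `¬ (NTIME g ⊆ sigmaLin 1)`. -/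
theorem not_NTIME_subset_sigmaLin_one {g : ℕ → ℕ} (hg : IsTimeConstructible g)
    (hlittle : (fun n => ((n + 1 : ℕ) : ℝ)) =o[atTop] fun n => (g n : ℝ)) : ¬ (NTIME g ⊆ sigmaLin 1) :=
  fun h => stub_speedup_false_at_level_le_one ⟨g, 1, le_rfl, hg, hlittle, h⟩

end Summit.PneNP.PneNP.Theorems.ConlinNotInNlin.Negative
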